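import Literature.Probability.RandomPlanarGeometry.HexParafermion
import Literature.Probability.RandomPlanarGeometry.HexSAW
import Literature.Barriers.CriticalPhenomena.ParafermionicHalfCauchyRiemann

/-!
# Vocabulary of line `spin-chord` for the crux `ArrivalFlattening` (stmt-CriticalPhenomena-16770)

Route `SAWSpinMonotone` (sub-problem `CriticalPhenomena/SAWScalingLimit`), crux
`Summit.CriticalPhenomena.SAWScalingLimit.Theses.SAWSpinMonotone.ArrivalFlattening` (item stmt-CriticalPhenomena-16770):
for every `ε > 0` there is a depth `R` such that for every simply connected hexagonal domain `Λ`, boundary mid-edge `a`,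
`R`-deep vertex `v ∈ Λ` and pairwise distinct neighbours `w₀ w₁ w₂` of `v`, `‖A_v(11/8)‖ ≤ ε ‖A_v(5/8)‖`, where
`A_v(s) = Σⱼ F_{Λ.erase v}(a, {v,wⱼ}; x_c, s)` is the spin-`s` transform of the first-arrival winding law at `v`
(Duminil-Copin–Smirnov's parafermionic observable of the punctured domain `Λ ∖ {v}`, summed over the three ports).

This file is the **definitions module** of the checked skeleton `Cruxes/ArrivalFlattening/Lines/spin_chord.lean`
(strategist `planner-cstrat-stmt-CriticalPhenomena-16770-b1-0`, lead `prover-line-stmt-CriticalPhenomena-16770-0`,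
`ledger skeleton check` OK, four registered stubs `stub_threeSpinChord : ThreeSpinChord`,
`stub_spinMonotonePair : SpinMonotonePair`, `stub_exitSpinBound : ExitSpinBound`, `stub_throughMassDecay : ThroughMassDecay`):
it carries, sorry-free and in the skeleton's namespace, the line's VOCABULARY — `arrivalTransform` (the `A_v(s)` above,
literally the crux's `G s s(v,w₀) + G s s(v,w₁) + G s s(v,w₂)`), `AtDepth R P` (verbatim the crux's binder block),
`portMass` (the `x_c`-mass of the arrivals along one port), `ThroughMass` (the `x_c`-mass of the walks from `a` through `v`
to the outer boundary) — and the five STATEMENTS the skeleton composes: `ThreeSpinChord` (S1), `SpinMonotonePair` (S2),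
`ExitSpinBound` (S3), `ThroughMassDecay` (S4) and the derived milestone `MonopoleDecay` — plus ONE elementary API
inequality, the registered glue sub-goal `norm_arrivalTransform_le` (`‖A(s)‖ ≤ ‖A(0)‖`, with `portMass_nonneg`,
`arrivalTransform_zero`, `norm_arrivalTransform_zero`), so that the stub helper files
`Theorems/SAWSpinMonotoneArrivalFlattening<StubName>.lean` (each proving `theorem <stubName> : <signature>` by name,
`--supports stmt-CriticalPhenomena-16770`) and the closing skeleton share ONE copy of every object (precedent:
`Theorems/CardyComplexConeDefs.lean`). Nothing in this file is asserted: every `def … : Prop` is a statement to be proved by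
a registered stub or by the skeleton's glue (`monopoleDecay_of : SpinMonotonePair → ExitSpinBound → ThroughMassDecay →
MonopoleDecay`, `arrivalFlattening_of_chord_of_monopoleDecay : ThreeSpinChord → MonopoleDecay → ArrivalFlattening`,
both kernel-checked in the skeleton). The bodies below are byte-identical to the skeleton's §1–§2.

Winding-law dictionary behind the names (card `Lines/spin-chord.md`): writing the first-arrival law as positive masses
`a_m` on the classes `W = θ₀ + 120°·m` and `P(θ) = Σ a_m e^{-imθ}`, `‖A_v(s)‖ = |P(120° s)|`, so `A_v(0)` is the MASS,
`‖A_v(3/8)‖ = |P(45°)|`, `‖A_v(5/8)‖ = |P(75°)|`, `‖A_v(11/8)‖ = |P(165°)|`.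

Sources: H. Duminil-Copin, S. Smirnov, *The connective constant of the honeycomb lattice equals `√(2+√2)`*, Ann. of
Math. 175 (2012) 1653–1665 (arXiv:1007.0575), §1–2 (walks between mid-edges, Definition 1, Lemma 1); the line card
`Cruxes/ArrivalFlattening/Lines/spin-chord.md` and `Cruxes/ArrivalFlattening/STRATEGY-CENSUS.md`. Deliberately NOT here:
any statement of the line as a theorem, the rest of the elementary API (`atDepth_mono`, `chord_step`, `throughMass_nonneg`,
… stay with the skeleton / the stub files), the crux itself (it is the route decl, imported by the skeleton from the Theses file).
-/

noncomputable section

namespace Summit.CriticalPhenomena.SAWScalingLimit.Cruxes.ArrivalFlattening.SpinChord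

open Literature.Probability.LatticeModels
open Literature.Probability.RandomPlanarGeometry Literature.Probability.RandomPlanarGeometry.SAW
open Literature.Barriers.CriticalPhenomena.HexGreen (nbrs)

/-! ## Objects -/

/-- **The first-arrival spin-`s` transform at `v`**: `A_v(s) = Σⱼ F_{Λ∖v}(a, {v,wⱼ}; x_c, s)` — the sum of
`x_c^{ℓ(γ)} e^{-isW(γ)}` over the self-avoiding walks of `Λ ∖ {v}` from `a` to the three ports of `v` (the
quantity `G s s(v,w₀) + G s s(v,w₁) + G s s(v,w₂)` of the crux `ArrivalFlattening`, DCS 2012 Definition 1 in the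
punctured domain). -/
def arrivalTransform (Λ : Finset HexVertex) (a : Sym2 HexVertex) (v w₀ w₁ w₂ : HexVertex) (s : ℝ) : ℂ :=
  hexParafermionicObservable (Λ.erase v) a hexCriticalFugacity s s(v, w₀) +
    hexParafermionicObservable (Λ.erase v) a hexCriticalFugacity s s(v, w₁) +
    hexParafermionicObservable (Λ.erase v) a hexCriticalFugacity s s(v, w₂)

/-- **`AtDepth R P`**: the property `P` of a configuration `(Λ, a, v, w₀, w₁, w₂)` holds for every ADMISSIBLE `R`-DEEP
configuration — `Λ` simply connected, `a ∈ ∂Λ`, `v ∈ Λ` with its Euclidean `R`-ball of vertices inside `Λ`, and `w₀, w₁, w₂`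
pairwise distinct neighbours of `v` (verbatim the binder block of the crux `ArrivalFlattening`). -/
def AtDepth (R : ℝ)
    (P : Finset HexVertex → Sym2 HexVertex → HexVertex → HexVertex → HexVertex → HexVertex → Prop) : Prop :=
  ∀ (Λ : Finset HexVertex), hexDomainSimplyConnected Λ → ∀ a ∈ hexDomainBoundary Λ, ∀ v ∈ Λ,
    (∀ w : HexVertex, dist (hexCenter w) (hexCenter v) ≤ R → w ∈ Λ) →
    ∀ w₀ w₁ w₂ : HexVertex, hexGraph.Adj v w₀ → hexGraph.Adj v w₁ → hexGraph.Adj v w₂ →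
      w₀ ≠ w₁ → w₁ ≠ w₂ → w₀ ≠ w₂ → P Λ a v w₀ w₁ w₂

/-- The mass of arrivals along one port: `Σ_γ x_c^{ℓ(γ)}` over the walks of `Λ ∖ {v}` from `a` to `{v, w}` (at spin `0`
the observable of the punctured domain at `{v, w}` is this real number, `hexParafermionicObservable_zero_spin`). -/
def portMass (Λ : Finset HexVertex) (a : Sym2 HexVertex) (v w : HexVertex) : ℝ :=
  ∑ γ : HexMidEdgeSAW (Λ.erase v) a s(v, w), hexCriticalFugacity ^ γ.length

/-- **The through-`v` mass to the outer boundary**: `Σ_{z ∈ ∂Λ} (F_Λ(a, z; x_c, 0) - F_{Λ∖v}(a, z; x_c, 0))`, the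
`x_c`-mass of the self-avoiding walks of `Λ` from `a` that VISIT `v` and end on a boundary mid-edge `z = {t, u}` of `Λ`
(`u ∈ Λ`, `t ∉ Λ`; at spin `0` the observable is the real mass `Σ x_c^ℓ`, and the walks of `Λ ∖ v` are exactly the walks
of `Λ` avoiding `v`). The outer darts are enumerated as in `HexGreen.hexFlux`: `u ∈ Λ`, `t ∈ nbrs u` with `t ∉ Λ`. -/
def ThroughMass (Λ : Finset HexVertex) (a : Sym2 HexVertex) (v : HexVertex) : ℝ :=
  ∑ u ∈ Λ, ∑ t ∈ (nbrs u).filter (· ∉ Λ),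
    (‖hexParafermionicObservable Λ a hexCriticalFugacity 0 s(t, u)‖ -
      ‖hexParafermionicObservable (Λ.erase v) a hexCriticalFugacity 0 s(t, u)‖)

/-! ## Statements (to be proved; nothing is asserted here) -/

/-- **(C) Three-spin chord inequality** (registered stub `stub_threeSpinChord`; shape of the spin profile at
`0, 5/8, 11/8`): there are `K > 0` and a depth `R₁` such that for every admissible `R₁`-deep configuration
`‖A(11/8)‖ · ‖A(0)‖^K ≤ ‖A(5/8)‖^{1+K}` — equivalently (non-zero masses) `‖A(11/8)‖/‖A(5/8)‖ ≤ (‖A(5/8)‖/‖A(0)‖)^K`.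
Conjecture-grade (exact enumeration: `K ≥ 1.18` over > 60 000 laws, `≥ 1.5` from depth `1.5` on; Coulomb gas `K → 48/25`);
NOT a property of general positive laws (single-port laws have `|P(165°)| = |P(75°)|`). A statement to be proved, not
asserted here. -/
def ThreeSpinChord : Prop :=
  ∃ K R₁ : ℝ, 0 < K ∧ AtDepth R₁ (fun Λ a v w₀ w₁ w₂ =>
    ‖arrivalTransform Λ a v w₀ w₁ w₂ (11 / 8)‖ * ‖arrivalTransform Λ a v w₀ w₁ w₂ 0‖ ^ K ≤
      ‖arrivalTransform Λ a v w₀ w₁ w₂ (5 / 8)‖ ^ (1 + K))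

/-- **(D) Monopole decay** (derived milestone, `monopoleDecay_of` in the skeleton): for every `η > 0` there is a depth
`R` such that for every admissible `R`-deep configuration `‖A(5/8)‖ ≤ η ‖A(0)‖` — the spin-`5/8` transform of the
first-arrival winding law is `o(mass)`, uniformly in the simply connected far field (expected rate `R^{-25/48}`). A
statement to be proved, not asserted here. -/
def MonopoleDecay : Prop :=
  ∀ η : ℝ, 0 < η → ∃ R : ℝ, AtDepth R (fun Λ a v w₀ w₁ w₂ =>
    ‖arrivalTransform Λ a v w₀ w₁ w₂ (5 / 8)‖ ≤ η * ‖arrivalTransform Λ a v w₀ w₁ w₂ 0‖)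

/-- **(P) Spin-monotone pair** `(3/8, 5/8)` (registered stub `stub_spinMonotonePair`): beyond some depth
`‖A(5/8)‖ ≤ ‖A(3/8)‖` — the instance `3/8 ≤ 5/8` of the route's rank-2 crux `SpinMonotone` (stmt-CriticalPhenomena-16769;
`spinMonotonePair_of_spinMonotone` in the skeleton, any `R₂`). A statement to be proved, not asserted here. -/
def SpinMonotonePair : Prop :=
  ∃ R₂ : ℝ, AtDepth R₂ (fun Λ a v w₀ w₁ w₂ =>
    ‖arrivalTransform Λ a v w₀ w₁ w₂ (5 / 8)‖ ≤ ‖arrivalTransform Λ a v w₀ w₁ w₂ (3 / 8)‖)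

/-- **(E) Exit-spin bound** (registered stub `stub_exitSpinBound`): at every `1`-deep configuration
`‖A_v(3/8)‖ ≤ ThroughMass Λ a v` — by the punctured contour identity (DCS Lemma 1 summed over `Λ ∖ v` with the OUTER root,
minus the same sum over `Λ`) the `3/8`-character of the first-arrival law equals, up to the factor `h/2`, the
direction-weighted sum of the through-`v` observable over the outer boundary, whose terms have moduli at most the
through-`v` masses. A statement to be proved, not asserted here. -/
def ExitSpinBound : Prop :=
  AtDepth 1 (fun Λ a v w₀ w₁ w₂ => ‖arrivalTransform Λ a v w₀ w₁ w₂ (3 / 8)‖ ≤ ThroughMass Λ a v)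

/-- **(T) Through-mass decay** (registered stub `stub_throughMassDecay`, the HARDEST: a two-arm / one-arm positive-mass
comparison at a deep point, uniformly over simply connected far fields): for every `η > 0` there is a depth `R` such that at
every admissible `R`-deep configuration `ThroughMass Λ a v ≤ η ‖A_v(0)‖` (expected rate `R^{-9/48}`; only this arrival-AVERAGED
form — the sup over first-arrival prefixes is false, census N4). Conjecture-grade; a statement to be proved, not asserted here. -/
def ThroughMassDecay : Prop :=
  ∀ η : ℝ, 0 < η → ∃ R : ℝ, AtDepth R (fun Λ a v w₀ w₁ w₂ =>
    ThroughMass Λ a v ≤ η * ‖arrivalTransform Λ a v w₀ w₁ w₂ 0‖)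

/-! ## The registered glue sub-goal: mass domination `‖A(s)‖ ≤ ‖A(0)‖` -/

/-- Port masses are non-negative (`x_c > 0`). [folklore] -/
theorem portMass_nonneg (Λ : Finset HexVertex) (a : Sym2 HexVertex) (v w : HexVertex) :
    0 ≤ portMass Λ a v w :=
  Finset.sum_nonneg fun _ _ => pow_nonneg hexCriticalFugacity_pos_lt_one.1.le _

/-- At spin `0` the transform IS the mass: `A(0) = m₀ + m₁ + m₂` (real, non-negative). [folklore] -/
theorem arrivalTransform_zero (Λ : Finset HexVertex) (a : Sym2 HexVertex) (v w₀ w₁ w₂ : HexVertex) :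
    arrivalTransform Λ a v w₀ w₁ w₂ 0 =
      ((portMass Λ a v w₀ + portMass Λ a v w₁ + portMass Λ a v w₂ : ℝ) : ℂ) := by
  simp only [arrivalTransform, portMass, hexParafermionicObservable_zero_spin, Complex.ofReal_add]

/-- `‖A(0)‖ = m₀ + m₁ + m₂`. [folklore] -/
theorem norm_arrivalTransform_zero (Λ : Finset HexVertex) (a : Sym2 HexVertex) (v w₀ w₁ w₂ : HexVertex) :
    ‖arrivalTransform Λ a v w₀ w₁ w₂ 0‖ = portMass Λ a v w₀ + portMass Λ a v w₁ + portMass Λ a v w₂ := by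
  rw [arrivalTransform_zero, Complex.norm_real, Real.norm_of_nonneg]
  exact add_nonneg (add_nonneg (portMass_nonneg _ _ _ _) (portMass_nonneg _ _ _ _)) (portMass_nonneg _ _ _ _)

/-- **Mass domination** `‖A(s)‖ ≤ ‖A(0)‖` for every spin `s` (triangle inequality: the winding factors are unimodular) —
the `s = 0` endpoint of the FM order; it closes the degenerate cases of the skeleton's composition `flatLimit_of`.
Registered glue sub-goal of the line (`ledger workitem stub-add … --name norm_arrivalTransform_le`). [folklore] -/
theorem norm_arrivalTransform_le : ∀ (Λ : Finset HexVertex) (a : Sym2 HexVertex) (v w₀ w₁ w₂ : HexVertex) (s : ℝ),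
    ‖arrivalTransform Λ a v w₀ w₁ w₂ s‖ ≤ ‖arrivalTransform Λ a v w₀ w₁ w₂ 0‖ := by
  intro Λ a v w₀ w₁ w₂ s
  rw [norm_arrivalTransform_zero]
  have hx : (0 : ℝ) ≤ hexCriticalFugacity := hexCriticalFugacity_pos_lt_one.1.le
  refine (norm_add₃_le).trans ?_
  exact add_le_add (add_le_add (norm_hexParafermionicObservable_le _ _ hx _ _)
    (norm_hexParafermionicObservable_le _ _ hx _ _)) (norm_hexParafermionicObservable_le _ _ hx _ _)

end Summit.CriticalPhenomena.SAWScalingLimit.Cruxes.ArrivalFlattening.SpinChord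

end
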